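import Mathlib
import HarnessLib
import HarnessLib.Audit
import Summits.AnomalousDissipation.Statement
import HarnessLib.Audit.Status.Attr

/-!
Route: Sparks

DORMANT since 2026-08-23T04:16:31Z (reconciler: no traction for 5.9 d (last activity item-evidence-added at 2026-08-17T06:18:50Z); parked, not closed — `ledger route dormant route-AnomalousDissipation-Sparks --off` to reactivate) — unstaffed, not closed; items shared with open routes are served there. `ledger route dormant <id> --off` reactivates.

# Route Sparks — AnomalousDissipation (Literature.Turb.ZerothLaw); realises idea card
sparks-recurrent-calm-forces-euler-blowup

## Thesis X (words) — "SparkCycle"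
The zeroth law is carried by RECURRENT SPARKS, not by a statistically steady cascade: there are a
smooth steady force f
(div-free, mean zero), a set S of CALM STATES (think: the burst-exit state(s) reached from the
inviscidly charged
eigenstate branch a·f_e along its inviscid instability — NOT the eigenstates themselves, which are
Euler-tame and burn
only O(ν)), a calm radius δ > 0, an Onsager quantum q > 0, a burn time Tb, a return time Tr ≥ Tb,
and ν₀ > 0 such that,
for every viscosity ν < ν₀,
 (IGNITION) every global Leray–Hopf solution of NS_ν forced by f whose finite-energy datum is
δ-close in L² to S burns
            at least q:  ν ∫₀^{Tb} ‖∇u‖₂² ≥ q   (spectral gradient norm, the integrand of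
`meanDissipation`);
 (RETURN)   some global Leray–Hopf solution keeps ∫|u(t)|² ≤ E for all t ≥ 0 and, in every window
[kTr,(k+1)Tr], passes
            through a time s at which it restarts as a global Leray–Hopf solution from u(s) (a
"good" time) with u(s)
            δ-close in L² to S (re-charged, about to burst again).
It suffices to show X: cycle bookkeeping (item Assembly; disjoint burn windows for even k, Cesàro
means ≥ q/(4Tr),
energies ≤ E, ν_j := ν₀/(j+2)) gives Literature.Turb.ZerothLaw = AnomalousDissipation with ε =
q/(4Tr).

## Thesis X (Lean; decl SparksThesis = stmt-AnomalousDissipation-1183, with the MemLp binder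
restated 2026-08-15; abbreviations: Torus.IsGlobalLerayHopf, Torus.eGradNormSq, eLpNorm · 2 volume)
Lean: ∃ f, IsSmooth f ∧ IsDivFree f ∧ HasZeroMean f ∧ ∃ (S : Set (T³ → ℝ³)) (δ q E Tb Tr ν₀ : ℝ),
0<δ ∧ 0<q ∧ 0<Tb ∧ Tb ≤ Tr ∧ 0<ν₀ ∧ (∀ ν u₀ u, 0<ν → ν<ν₀ → IsGlobalLerayHopf ν (fun _ => f) u₀ u →
MemLp u₀ 2 volume → (∃ U ∈ S, eLpNorm (u₀ - U) 2 volume ≤ ofReal δ) → q ≤ ν * (∫⁻ t in Ioo 0 Tb,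
eGradNormSq (u t)).toReal) ∧ (∀ ν, 0<ν → ν<ν₀ → ∃ u₀ u, IsGlobalLerayHopf ν (fun _ => f) u₀ u ∧ (∀ t
≥ 0, ∫ x, ‖u t x‖^2 ≤ E) ∧ ∀ k : ℕ, ∃ s ∈ Icc (k*Tr) ((k+1)*Tr), IsGlobalLerayHopf ν (fun _ => f) (u
s) (fun t => u (s+t)) ∧ ∃ U ∈ S, eLpNorm (u s - U) 2 volume ≤ ofReal δ)

## How the cruxes reach X (route-choice repair 2026-08-16), and the price
X is an existential whose IGNITION and RETURN halves share the witnesses (f, S, δ), so any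
decomposition must pin them:
S = {U₀}, δ = δ₂ < δ₁ for ONE ball.  RecurrentBlowupBall (crux #4) = the card's Hyp1 ∧ Hyp3 in the
only topology the
Leray–Hopf framework offers: an L²-BALL B_{δ₁}(U₀) of smooth div-free data none of which launches a
classical solution
of Euler forced by f on [0,T] (L²-robust steady-forced Euler blow-up), re-entered δ₂-deep at a good
restart time in
every window Tr by bounded-energy global Leray–Hopf flows, for all ν < ν₁.  SingularitiesDissipate
(crux #3, pointwise:
a breakdown state ignites at SOME radius, quantum, delay) makes every smooth point of the ball an
igniting state;
UniformIgnition (crux #5) makes quantum, burn window and viscosity threshold UNIFORM on the smaller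
ball B_{δ₂}(U₀);
IgnitionReturnGlue (support; proved in the planner's Sketch.lean, 35 lines: Tb from #5, Tr' = N·Tr ≥
Tb, ν₀ = min)
yields X.  The price is explicit and half of it PROVABLY necessary: by WindowStability (support:
Leray–Hopf vs classical
forced Euler, same steady force, L²-close data, ν∫₀ᵀ‖∇u‖² ≤ C_U(δ² + ν) — the BDS2011/BDL2023
relative-energy engine)
and Hopf existence, IGNITION δ-near S forces finite-time breakdown of smooth-forced Euler from EVERY
smooth div-free
datum δ-close to S (BreakdownOfIgnition): X itself presupposes an L²-ball of blow-up data, i.e. crux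
#2
SteadyForcedEulerBreakdown in the robust form built into #4 (BreakdownOfBall: #4 → #2, proved in
Sketch.lean).
Conversely CalmRecurrenceNoAnomaly (support, unconditional, offered to all routes): recurrent calm
visits with
δ_j → 0 near uniformly Euler-tame data force meanDissipation → 0 — "turbulence cannot rest near tame
Euler data"
(Bruè–De Lellis's finite-window deterrent made long-time).

Rationale: WHY THIS LINE. Every rigorous long-time anomaly (Cheskidov2023 Thm 1.3, BrueDeLellisCMP2023 Thm 1.1)
designs a permanent
cascade with ν-dependent forces; steadily forced box turbulence is in fact quasi-CYCLIC
(YasudaGotoKawahara2014,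
GotoSaitoKawahara2017; the UPO of VanVeenVelaMartinKawahara2019 is one charge–cascade–discharge
cycle). The card imports the
relaxation-oscillator picture (dynamical systems) and pays for it with the
weak–strong/relative-energy engine of
BrenierDeLellisSzekelyhidi2011 Cor. 1 and BrueDeLellisCMP2023 App. Lemma 7 (both DISCHARGED in
tree), used as a RESOURCE:
the charging phase u = a(t)f_e is exact and ν-uniform, all difficulty is isolated in one
finite-window event "break
down, burn ≥ q, come back", and the entry fee — smooth steadily-forced Euler breakdown on T³,
L²-robustly — is an
explicit ranked crux instead of being smuggled. Geometric reading (Arnold;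
Khesin–Misiołek–Shnirelman arXiv:2205.01143):
anomaly ⟺ reachable geodesic incompleteness of SDiff (Burgers/CH/HS break and dissipate; SDiff(T²)
complete, no 2-D law).
RANKED CRUXES. #2 SteadyForcedEulerBreakdown (∃ smooth steady f, smooth div-free U₀, T: no classical
forced-Euler solution
on [0,T] from U₀ — the named unproved fact; implied by #4 via BreakdownOfBall). #3
SingularitiesDissipate (pointwise
hinge: every breakdown state ignites — ∃ q τ ν₀ δ, all LH solutions of NS_ν, ν<ν₀, from
finite-energy data δ-close to
U₀ burn ν∫₀^{T+τ}‖∇u‖² ≥ q; Onsager's ideal turbulence at a singular event vs Cheskidov's escape to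
k = ∞). #4
RecurrentBlowupBall (Hyp1 ∧ Hyp3 for ONE f and ONE ball: every smooth div-free datum of the closed
L²-ball B_{δ₁}(U₀)
breaks down by T, and for all ν<ν₁ a bounded-energy global LH flow re-enters B_{δ₂}(U₀), δ₂<δ₁, at a
good restart time
in every window Tr — the dynamical heart, route-specific, ranked after the two named facts it
presupposes). #5
UniformIgnition (pointwise ignition of every smooth div-free state of B_{δ₁}(U₀) ⇒ ONE
quantum/window/threshold on
B_{δ₂}(U₀); smooth data are meagre in L², no Baire shortcut). SUPPORT: WindowStability (engine,
provable now),
BreakdownOfIgnition (ignition ⇒ breakdown), CalmRecurrenceNoAnomaly (unconditional T2'),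
IgnitionReturnGlue (#3 → #5 →
#4 → SparksThesis; proved in Sketch.lean), BreakdownOfBall (#4 → #2; proved in Sketch.lean),
Assembly (SparksThesis →
AnomalousDissipation, ε = q/(4Tr)). Deciding chain: closes = Assembly ∘ IgnitionReturnGlue (cruxes
#3, #5, #4).
KILL CRITERIA. Route closes `refuted` if ¬SparksThesis is proved outright; if #3 is refuted in a way
covering
point-collapse/generic breakdowns (a Cheskidov-2.1-type escape AT a genuine smooth-data
singularity); if an L²-DENSITY
theorem for Euler-tame data lands (every L²-ball around a smooth div-free state contains a smooth
datum launching a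
classical forced-Euler solution on [0,T]; cf. oscillation-generated global solutions for NS,
CheminGallagherPaicu2011) —
it kills #4 and, through BreakdownOfIgnition, X; or if freshly burnt LH flows provably stay ≥
c(q)-far in L² from every
bounded smooth set for times ≫ 1 (RETURN dead ⇒ permanent cascade;
WindowStability/CalmRecurrenceNoAnomaly survive as
Neg-side knowledge). Global regularity of smooth steadily-forced Euler on T³ kills #2, #4 and X.
NOT DECOMPOSED YET. The charging lemma (u = a(t)f_e, ȧ = 1 − νλa, exact global classical solution
for Beltrami/shear
eigen-forces) and the instability/exit-state description of U₀ — cheap supports once #4 is attacked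
constructively; the
Kato/compactness upgrade of CalmRecurrenceNoAnomaly (classical from each point of a C^k-compact S ⇒
uniform C); DNS test
of deep recurrence (card P6: min-over-cycle ‖u − P_{≤K}u‖₂ vs Re); ¬X special cases (shear / 2½-D
calm sets:
BardosTitiWiedemann2012 selection ⇒ no ignition) are refuter exercises, not items.
CHEAPEST FALSIFIER. For the line: the L²-density question for T-tame smooth data — is {smooth
div-free V : Euler forced by
f is classical on [0,T] from V} L²-dense near a candidate exit state U₀ (ask it first for f = 0)? A
positive answer
kills every blow-up ball, hence #4 and X. For #5/#3: a vanishing-viscosity LH family from FIXED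
rough finite-energy data
deep inside a would-be ignition ball whose burn is o(1) (shear-type selection,
BardosTitiWiedemann2012; escape without
burn, Cheskidov2023 Thm 2.1). Numerically: card P6 (quasi-cyclic steady ABC/second-shell forcing,
recurrence depth vs Re).
TWO-LAYER PLAN. Layer 1 = the items above (4 cruxes, 5 supports, target, assembly: 11 ≤ 15). Layer 2
only by glued
splits of #4 (blow-up ball | deep return) or #5 once a half moves; never a third layer.
SOURCES. BrueDeLellisCMP2023 (= arXiv:2207.06301 §1, App. Lemma 7), BrenierDeLellisSzekelyhidi2011,
Constantin1986,
Cheskidov2023 (arXiv:2311.04182 Thm 1.3/2.1), YasudaGotoKawahara2014, GotoSaitoKawahara2017,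
VanVeenVelaMartinKawahara2019,
Elgindi2021AnnMath, ElgindiGhoulMasmoudi2021, ChenHou2025, CordobaMartinezZoroa2023,
BardosTitiWiedemann2012,
DrivasEyink2019, CheminGallagherPaicu2011, arXiv:2205.01143, Hopf1951, DoeringFoias2002.

Novelty: NOVELTY (planner, 2026-08-15; searches run BEFORE this claim: `lit frontier AnomalousDissipation
--since 2020`, `lit bridges
AnomalousDissipation --cross any`, `lit search --hybrid "anomalous dissipation Euler blow-up
necessary weak-strong uniqueness
vanishing viscosity forced long time average"`, `lit vsearch` (two phrasings of "anomaly forces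
Euler blow-up / NS tracks
Lipschitz Euler"), `lit search --source crossref "anomalous dissipation Euler blow-up Navier-Stokes
vanishing viscosity"`,
`lit galaxy search --star all` ("quasi-cyclic evolution of turbulence driven by a steady force",
"beyond the blow-up time of
Euler"), `lit galaxy search --star pdf --mode bm25` (question form), `lit read arxiv:2207.06301`
pp.3,5,18; OpenAlex/S2/arXiv
were HTTP 429 all session; plus the card's and two refuter audits' searches (new-combination,
confirmed gen-1)).
Nearest prior art actually found: (i) BrueDeLellis2023 = arXiv:2207.06301 p.3 §1 ("can only hold if
T is larger than the
first blow-up time of some suitable classical solution of the incompressible Euler equations … would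
settle, as a corollary,
the blow-up problem … (on the negative)") with p.18 Lemma 7 (relative-energy Grönwall for CLASSICAL
NS vs Lipschitz forced
Euler; the Leray case "left to the reader") — in tree as
Literature.Barriers.AnomalousDissipation.BrueDeLellis2023_
noAnomaly_beforeEulerSingularity(+Narrow), DISCHARGED; (ii) BrenierDeLellisSzekelyhidi2011 Cor. 1
(Leray solutions converge
to a regular Euler solution whi  [refs: 10.1088/0169-5983/46/6/061413, 2207.06301, 1310.8611, arxiv:2207.06301, doi:10.1088/0169-5983/46/6/061413, BrueDeLellis2023, BrenierDeLellisSzekelyhidi2011, Constantin2007, YasudaGotoKawahara2014, GotoSaitoKawahara2017, VanVeenVelaMartinKawahara2019, Cheskidov2023]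

Barriers (technique_class: relaxation-oscillation euler-blow-up-conditional weak-strong): technique_class: relaxation-oscillation euler-blow-up-conditional weak-strong
- Literature.Barriers.AnomalousDissipation.BrueDeLellis2023_noAnomaly_beforeEulerSingularity: USED
AS THE ENGINE, not evaded — WindowStability is its Leray–Hopf/steady-force/L²-perturbed-data form;
the positive line goes BEYOND the Euler lifespan in every cycle, which is exactly what the barrier
says a finite-window anomaly must do; the price is filed as crux SteadyForcedEulerBreakdown.
- Literature.Barriers.AnomalousDissipation.BrueDeLellis2023_noAnomaly_beforeEulerSingularityNarrow:
its hypothesis (classical solvability of smooth-forced Euler on [0,1] for all smooth data/forces) is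
the NEGATION of crux #2 up to scaling; if that hypothesis is ever proved the route dies by
BreakdownOfIgnition — recorded as kill criterion, not evaded.
- Literature.Barriers.AnomalousDissipation.BrenierDeLellisSzekelyhidi2011_cor1: same engine (Leray
class, whole space, unforced); the audit note that strongly-L²-convergent ν-dependent data are
covered is precisely the fact CalmRecurrenceNoAnomaly exploits; evasion of the positive line = work
past the regularity time (its evasions_known (1)).
- Literature.Barriers.AnomalousDissipation.Cheskidov2023_thm21_noDissipationAnomaly: APPLIES head-on
to crux #3 (energy can escape to infinite frequency with zero viscous burn in designed families);
NOT evaded — SingularitiesDissipate is the explicit bet that undesigned singularities reached from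
smooth data under a steady smooth f

History (route lifecycle, newest last):
- 2026-08-23T04:16:31Z · DORMANT — reconciler: no traction for 5.9 d (last activity item-evidence-added at 2026-08-17T06:18:50Z); parked, not closed — `ledger route dormant route-AnomalousDissipa (operator:999:906303)

sub-problem: AnomalousDissipation · status: dormant · opened planner-plancard-AnomalousDissipation-Anomalo-6774a036-0 2026-08-15T10:53:19Z · rev 3 · ledger route-AnomalousDissipation-Sparks
GENERATED by the gate from the ledger (D-0016/17). Provers cite these decls: `theorem foo : Summit.AnomalousDissipation.AnomalousDissipation.Theses.Sparks.<Decl> := …` in Summits/AnomalousDissipation/AnomalousDissipation/Theorems/<Name>.lean.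
-/

namespace Summit.AnomalousDissipation.AnomalousDissipation.Theses.Sparks

open scoped BigOperators Topology Manifold Classical MeasureTheory ProbabilityTheory Matrix InnerProductSpace ComplexConjugate ContinuousMap
open Filter Set Function TopologicalSpace MeasureTheory

attribute [summit_statement] _root_.AnomalousDissipation

open Literature.Turb

/-- item stmt-AnomalousDissipation-1183 · target · rank 0 · open · by planner
why it might fail: Needs Euler breakdown at calm states, L2-robust ignition (#2,#3) and nu-uniform bounded-energy return (debris may stay far from S). AS TYPED u0 need not be measurable: U*1_A (A non-measurable) is an LH datum of the REST flow, delta=0, so IGNITION makes NS-from-rest burn >=q: false for Beltrami f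
sources: YasudaGotoKawahara2014, VanVeenVelaMartinKawahara2019, GotoSaitoKawahara2017, BrueDeLellis2023, Literature.Analysis.FluidPDE.Torus.IsLerayHopfOn, Literature.Barriers.AnomalousDissipation.BrueDeLellis2023_noAnomaly_beforeEulerSingularity
[target] SparkCycle X: ∃ smooth steady f (div-free, mean-zero), calm set S, δ,q,E,Tb ≤ Tr, ν₀ with
IGNITION (every global Leray–Hopf solution of NS_ν, ν<ν₀, from a datum δ-close in L² to S burns
ν∫₀^{Tb}‖∇u‖² ≥ q, spectral eGradNormSq) and RETURN (for each ν<ν₀ some global LH solution has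
∫|u(t)|² ≤ E ∀t≥0 and in every window [kTr,(k+1)Tr] a good restart time s — (fun t => u (s+t)) is
global LH from u s — with u s δ-close to S). Intended S: inviscidly charged eigenstates a·f_e (exact
NS solutions u = a(t)f_e, ȧ = 1−νλa, ν-uniform charging) plus small debris; burst = inviscid
instability of A·f_e. Presupposes cruxes #2,#3 (see BreakdownOfIgnition) and a ν-uniform
re-laminarisation (RETURN). Sources: card sparks-recurrent-calm-forces-euler-blowup;
YasudaGotoKawahara2014; GotoSaitoKawahara2017; VanVeenVelaMartinKawahara2019; BrueDeLellis2023 §1. -/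
@[route_item "route-AnomalousDissipation-Sparks"]
def SparksThesis : Prop :=
  ∃ f : UnitAddTorus (Fin 3) → EuclideanSpace ℝ (Fin 3), Literature.Analysis.FunctionSpaces.Torus.IsSmooth f ∧ Literature.Analysis.FunctionSpaces.Torus.IsDivFree f ∧ Literature.Analysis.FunctionSpaces.Torus.HasZeroMean f ∧ ∃ (S : Set (UnitAddTorus (Fin 3) → EuclideanSpace ℝ (Fin 3))) (δ q E Tb Tr ν₀ : ℝ), 0 < δ ∧ 0 < q ∧ 0 < Tb ∧ Tb ≤ Tr ∧ 0 < ν₀ ∧ (∀ (ν : ℝ) (u₀ : UnitAddTorus (Fin 3) → EuclideanSpace ℝ (Fin 3)) (u : ℝ → UnitAddTorus (Fin 3) → EuclideanSpace ℝ (Fin 3)), 0 < ν → ν < ν₀ → Literature.Analysis.FluidPDE.Torus.IsGlobalLerayHopf ν (fun _ => f) u₀ u → MeasureTheory.MemLp u₀ 2 MeasureTheory.volume → (∃ U ∈ S, MeasureTheory.eLpNorm (u₀ - U) 2 MeasureTheory.volume ≤ ENNReal.ofReal δ) → q ≤ ν * (MeasureTheory.lintegral (MeasureTheory.Measure.restrict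 MeasureTheory.volume (Set.Ioo 0 Tb)) (fun t => Literature.Analysis.FunctionSpaces.Torus.eGradNormSq (u t))).toReal) ∧ (∀ (ν : ℝ), 0 < ν → ν < ν₀ → ∃ (u₀ : UnitAddTorus (Fin 3) → EuclideanSpace ℝ (Fin 3)) (u : ℝ → UnitAddTorus (Fin 3) → EuclideanSpace ℝ (Fin 3)), Literature.Analysis.FluidPDE.Torus.IsGlobalLerayHopf ν (fun _ => f) u₀ u ∧ (∀ t : ℝ, 0 ≤ t → MeasureTheory.integral MeasureTheory.volume (fun x => ‖u t x‖ ^ 2) ≤ E) ∧ ∀ k : ℕ, ∃ s ∈ Set.Icc ((k : ℝ) * Tr) (((k : ℝ) + 1) * Tr), Literature.Analysis.FluidPDE.Torus.IsGlobalLerayHopf ν (fun _ => f) (u s) (fun t => u (s + t)) ∧ ∃ U ∈ S, MeasureTheory.eLpNorm (u s - U) 2 MeasureTheory.volume ≤ ENNReal.ofReal δ)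

/-- item stmt-AnomalousDissipation-1184 · crux · rank 2 · open · by planner
why it might fail: Smooth steadily-forced Euler on T3 may be globally regular ('widely open', BrueDeLellis2023 s.1): proven blow-ups need C^{1,a} data (Elgindi2021AnnMath, EGM2021), a boundary (ChenHou2025) or C^{1,1/2-} force on R3 (CordobaMartinezZoroa2023); 2026 smooth-interior claims (arXiv:2605.04526) unrefereed.
sources: BrueDeLellis2023, Elgindi2021AnnMath, ElgindiGhoulMasmoudi2021, ChenHou2025, CordobaMartinezZoroa2023, arXiv:2308.12197
[crux, rank 2 — the named UNPROVED fact the line runs on, filed first] Finite-time breakdown of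
classical solutions of the Euler equations on T³ driven by a smooth, steady, divergence-free,
mean-zero force: for some smooth div-free U₀ and T>0 no classical forced-Euler solution
(Torus.IsClassicalNSSolutionOn (Icc 0 T) 0 (fun _ => f) U P) on [0,T] has U 0 = U₀. Same shape as
the conclusion of BrueDeLellis2023_question22_imp_forcedEuler_breakdown (ClassicalEulerLimitProofs;
window normalisable to [0,1] by u_λ = λu(λt), f_λ = λ²f). For the architecture U₀ ranges over the
calm set S (charged eigenstates A·f_e); BreakdownOfIgnition shows X ⇒ this at every point of S.
Sources: BrueDeLellis2023 §1 ('still widely open'); Elgindi2021AnnMath; ChenHou2025;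
CordobaMartinezZoroa2023. -/
@[route_item "route-AnomalousDissipation-Sparks"]
def SteadyForcedEulerBreakdown : Prop :=
  ∃ f : UnitAddTorus (Fin 3) → EuclideanSpace ℝ (Fin 3), Literature.Analysis.FunctionSpaces.Torus.IsSmooth f ∧ Literature.Analysis.FunctionSpaces.Torus.IsDivFree f ∧ Literature.Analysis.FunctionSpaces.Torus.HasZeroMean f ∧ ∃ (U₀ : UnitAddTorus (Fin 3) → EuclideanSpace ℝ (Fin 3)) (T : ℝ), Literature.Analysis.FunctionSpaces.Torus.IsSmooth U₀ ∧ Literature.Analysis.FunctionSpaces.Torus.IsDivFree U₀ ∧ 0 < T ∧ ∀ (U : ℝ → UnitAddTorus (Fin 3) → EuclideanSpace ℝ (Fin 3)) (P : ℝ → UnitAddTorus (Fin 3) → ℝ), Literature.Analysis.FunctionSpaces.Torus.IsClassicalNSSolutionOn (Set.Icc 0 T) 0 (fun _ => f) U P → U 0 ≠ U₀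

/-- item stmt-AnomalousDissipation-1185 · crux · rank 3 · open · by planner
why it might fail: Energy may escape to k=infinity at a singularity with no burn (Cheskidov2023 Thm 2.1, e=0); L2 is far below critical: delta-close smooth data with classical Euler on [0,T+tau] burn O(nu) (weak-strong). AS TYPED non-measurable U0*1_A carry the rest flow: breakdown under rest-tame f refutes it.
sources: Cheskidov2023, arXiv:1310.8611, DrivasEyink2019, BrueDeLellis2023, BrenierDeLellisSzekelyhidi2011, Literature.Barriers.AnomalousDissipation.Cheskidov2023_thm21_noDissipationAnomaly
[crux, rank 3 — the hinge] SINGULARITIES IGNITE, quantitatively and L²-robustly: whenever smooth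
steadily-forced Euler from a smooth div-free U₀ has no classical solution on [0,T], there are q>0, a
delay τ≥0, ν₀>0, δ>0 such that EVERY global Leray–Hopf solution of NS_ν (ν<ν₀, same force) from ANY
datum δ-close to U₀ in L² burns ν∫₀^{T+τ}‖∇u‖² ≥ q (equivalently: liminf over every
vanishing-viscosity LH sequence with data → U₀ in L² is > 0). Its conclusion is literally IGNITION
with S = {U₀}; the converse (ignition ⇒ breakdown) is BreakdownOfIgnition. Isolates Onsager's 'ideal
turbulence at a singular event' against Cheskidov's escape-to-k=∞-without-burn (Thm 2.1); the delay
τ accommodates the onsager-quanta card (non-atomic collapses burn nothing AT T*; the quantum is a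
decay quantum of rough debris, arXiv:1310.8611). Failure modes: escape without burn; L²-small but
gradient-large localized perturbations defusing the singularity; laminar debris decay (q ≍ ν).
Sources: Cheskidov2023 Thm 2.1; arXiv:1310.8611; BrueDeLellis2023 §1; DrivasEyink2019. -/
@[route_item "route-AnomalousDissipation-Sparks", crux]
def SingularitiesDissipate : Prop :=
  ∀ f : UnitAddTorus (Fin 3) → EuclideanSpace ℝ (Fin 3), Literature.Analysis.FunctionSpaces.Torus.IsSmooth f → Literature.Analysis.FunctionSpaces.Torus.IsDivFree f → Literature.Analysis.FunctionSpaces.Torus.HasZeroMean f → ∀ (U₀ : UnitAddTorus (Fin 3) → EuclideanSpace ℝ (Fin 3)), Literature.Analysis.FunctionSpaces.Torus.IsSmooth U₀ → Literature.Analysis.FunctionSpaces.Torus.IsDivFree U₀ → ∀ (T : ℝ), 0 < T → (∀ (U : ℝ → UnitAddTorus (Fin 3) → EuclideanSpace ℝ (Fin 3)) (P : ℝ → UnitAddTorus (Fin 3) → ℝ), Literature.Analysis.FunctionSpaces.Torus.IsClassicalNSSolutionOn (Set.Icc 0 T) 0 (fun _ => f) U P → U 0 ≠ U₀) → ∃ (q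 τ ν₀ δ : ℝ), 0 < q ∧ 0 ≤ τ ∧ 0 < ν₀ ∧ 0 < δ ∧ ∀ (ν : ℝ) (u₀ : UnitAddTorus (Fin 3) → EuclideanSpace ℝ (Fin 3)) (u : ℝ → UnitAddTorus (Fin 3) → EuclideanSpace ℝ (Fin 3)), 0 < ν → ν < ν₀ → Literature.Analysis.FluidPDE.Torus.IsGlobalLerayHopf ν (fun _ => f) u₀ u → MeasureTheory.MemLp u₀ 2 MeasureTheory.volume → MeasureTheory.eLpNorm (u₀ - U₀) 2 MeasureTheory.volume ≤ ENNReal.ofReal δ → q ≤ ν * (MeasureTheory.lintegral (MeasureTheory.Measure.restrict MeasureTheory.volume (Set.Ioo 0 (T + τ))) (fun t => Literature.Analysis.FunctionSpaces.Torus.eGradNormSq (u t))).toReal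

/-- item stmt-AnomalousDissipation-14546 · crux · rank 4 · open · by planner
why it might fail: Needs an L2-BALL of smooth data ALL blowing up by T under a steady smooth force on T3 (no smooth-data blow-up known; known scenarios are C^{1,a}/boundary, stable only in strong norms; T-tame data may be L2-dense) AND nu-uniform deep returns into it (debris may never re-enter a fixed L2-ball).
sources: BrueDeLellisCMP2023, Elgindi2021AnnMath, ElgindiGhoulMasmoudi2021, ChenHou2025, CordobaMartinezZoroa2023, YasudaGotoKawahara2014
[crux, rank 4 — Hyp1 ∧ Hyp3 of the card for ONE force and ONE ball; the dynamical heart] There are a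
smooth steady div-free mean-zero force f, a smooth div-free EXIT STATE U₀, radii 0 < δ₂ < δ₁, a
blow-up time T > 0, an energy cap E, a return time Tr > 0 and ν₁ > 0 such that (BLOW-UP BALL,
L²-robust steady-forced Euler breakdown) no smooth div-free V with ‖V − U₀‖_{L²} ≤ δ₁ launches a
classical solution of Euler forced by f on [0,T] (Torus.IsClassicalNSSolutionOn (Icc 0 T) 0 (fun _
=> f) U P → U 0 ≠ V), and (DEEP RETURN) for every 0 < ν < ν₁ some global Leray–Hopf solution of NS_ν
forced by f keeps ∫|u(t)|² ≤ E for all t ≥ 0 and has in every window [kTr,(k+1)Tr] a good restart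
time s (t ↦ u(s+t) is global Leray–Hopf from u s) with ‖u s − U₀‖_{L²} ≤ δ₂. Intended witnesses: f =
Beltrami/second-shell eigen-force, U₀ = the burst-exit state on the inviscid unstable manifold of
the critically charged eigenstate A·f_e (δ₂-far from the tame laminar branch), returns =
relaminarise, recharge (u ≈ a(t)f_e exact), destabilise, exit again. Necessity: X ∧ WindowStability
⇒ an L²-ball of blow-up data (BreakdownOfIgnition at every smooth point δ-close to S), so the
blow-up-ball half is the price o -/
@[route_item "route-AnomalousDissipation-Sparks", crux]
def RecurrentBlowupBall : Prop :=
  ∃ f : UnitAddTorus (Fin 3) → EuclideanSpace ℝ (Fin 3), Literature.Analysis.FunctionSpaces.Torus.IsSmooth f ∧ Literature.Analysis.FunctionSpaces.Torus.IsDivFree f ∧ Literature.Analysis.FunctionSpaces.Torus.HasZeroMean f ∧ ∃ (U₀ : UnitAddTorus (Fin 3) → EuclideanSpace ℝ (Fin 3)) (δ₁ δ₂ T E Tr ν₁ : ℝ), Literature.Analysis.FunctionSpaces.Torus.IsSmooth U₀ ∧ Literature.Analysis.FunctionSpaces.Torus.IsDivFree U₀ ∧ 0 < δ₂ ∧ δ₂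 < δ₁ ∧ 0 < T ∧ 0 < Tr ∧ 0 < ν₁ ∧ (∀ V : UnitAddTorus (Fin 3) → EuclideanSpace ℝ (Fin 3), Literature.Analysis.FunctionSpaces.Torus.IsSmooth V → Literature.Analysis.FunctionSpaces.Torus.IsDivFree V → MeasureTheory.eLpNorm (V - U₀) 2 MeasureTheory.volume ≤ ENNReal.ofReal δ₁ → ∀ (U : ℝ → UnitAddTorus (Fin 3) → EuclideanSpace ℝ (Fin 3)) (P : ℝ → UnitAddTorus (Fin 3) → ℝ), Literature.Analysis.FunctionSpaces.Torus.IsClassicalNSSolutionOn (Set.Icc 0 T) 0 (fun _ => f) U P → U 0 ≠ V) ∧ ∀ ν : ℝ, 0 < ν → ν < ν₁ → ∃ (u₀ : UnitAddTorus (Fin 3) → EuclideanSpace ℝ (Fin 3)) (u : ℝ → UnitAddTorus (Fin 3) → EuclideanSpace ℝ (Fin 3)), Literature.Analysis.FluidPDE.Torus.IsGlobalLerayHopf ν (fun _ => f) u₀ u ∧ (∀ t : ℝ, 0 ≤ t → MeasureTheory.integral MeasureTheory.volume (fun x => ‖u t x‖ ^ 2) ≤ E) ∧ ∀ k : ℕ,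 ∃ s ∈ Set.Icc ((k : ℝ) * Tr) (((k : ℝ) + 1) * Tr), Literature.Analysis.FluidPDE.Torus.IsGlobalLerayHopf ν (fun _ => f) (u s) (fun t => u (s + t)) ∧ MeasureTheory.eLpNorm (u s - U₀) 2 MeasureTheory.volume ≤ ENNReal.ofReal δ₂

/-- item stmt-AnomalousDissipation-14547 · crux · rank 5 · open · by planner
why it might fail: Ignition radii/quanta of the smooth states may degenerate (delta_V, q_V -> 0) inside the ball, leaving rough data in B_{delta2} whose viscosity limits burn o(1) (shear selection BardosTitiWiedemann2012; escape to k=inf without burn, Cheskidov2023 Thm 2.1); no compactness, smooth data meagre in L2.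
sources: Cheskidov2023, BardosTitiWiedemann2012, DrivasEyink2019, Constantin1986, BrueDeLellisCMP2023, Literature.Barriers.AnomalousDissipation.Cheskidov2023_thm21_noDissipationAnomaly
[crux, rank 5 — ignition is locally uniform deep inside an igniting region] For a smooth steady
div-free mean-zero f, a smooth div-free U₀ and 0 < δ₂ < δ₁: if EVERY smooth div-free V with ‖V −
U₀‖_{L²} ≤ δ₁ ignites (own quantum q_V > 0, burn window Tb_V > 0, threshold ν_V > 0, radius δ_V > 0:
every global Leray–Hopf solution of NS_ν, ν < ν_V, from a finite-energy datum δ_V-close to V in L²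
burns ν∫₀^{Tb_V}‖∇u‖₂² ≥ q_V — literally the conclusion of SingularitiesDissipate at V with Tb_V = T
+ τ), then ONE quantum q, window Tb and threshold ν₀ serve all finite-energy data within δ₂ of U₀.
With SingularitiesDissipate it turns the blow-up ball of RecurrentBlowupBall into the uniform
ignition ball X needs (IgnitionReturnGlue). The bet: deep inside blow-up territory (δ₁ − δ₂ away
from any tame datum) the Onsager burn cannot degenerate along rough or symmetric data; no
compactness is available (the smooth data are meagre in the L²-ball), so this is analysis, not
Baire. [deps: SingularitiesDissipate] [difficulty: XL] Sources: Cheskidov2023 Thm 2.1;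
BardosTitiWiedemann2012; DrivasEyink2019; Constantin1986; BrueDeLellisCMP2023 App. Lemma 7. -/
@[route_item "route-AnomalousDissipation-Sparks", crux]
def UniformIgnition : Prop :=
  ∀ f : UnitAddTorus (Fin 3) → EuclideanSpace ℝ (Fin 3), Literature.Analysis.FunctionSpaces.Torus.IsSmooth f → Literature.Analysis.FunctionSpaces.Torus.IsDivFree f → Literature.Analysis.FunctionSpaces.Torus.HasZeroMean f → ∀ (U₀ : UnitAddTorus (Fin 3) → EuclideanSpace ℝ (Fin 3)), Literature.Analysis.FunctionSpaces.Torus.IsSmooth U₀ → Literature.Analysis.FunctionSpaces.Torus.IsDivFree U₀ → ∀ (δ₁ δ₂ : ℝ), 0 < δ₂ → δ₂ < δ₁ → (∀ V : UnitAddTorus (Fin 3) → EuclideanSpace ℝ (Fin 3), Literature.Analysis.FunctionSpaces.Torus.IsSmooth V → Literature.Analysis.FunctionSpaces.Torus.IsDivFree V → MeasureTheory.eLpNorm (V - U₀) 2 MeasureTheory.volume ≤ ENNReal.ofReal δ₁ → ∃ (q Tb ν₀ δ : ℝ), 0 < q ∧ 0 < Tb ∧ 0 < ν₀ ∧ 0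 < δ ∧ ∀ (ν : ℝ) (u₀ : UnitAddTorus (Fin 3) → EuclideanSpace ℝ (Fin 3)) (u : ℝ → UnitAddTorus (Fin 3) → EuclideanSpace ℝ (Fin 3)), 0 < ν → ν < ν₀ → Literature.Analysis.FluidPDE.Torus.IsGlobalLerayHopf ν (fun _ => f) u₀ u → MeasureTheory.MemLp u₀ 2 MeasureTheory.volume → MeasureTheory.eLpNorm (u₀ - V) 2 MeasureTheory.volume ≤ ENNReal.ofReal δ → q ≤ ν * (MeasureTheory.lintegral (MeasureTheory.Measure.restrict MeasureTheory.volume (Set.Ioo 0 Tb)) (fun t => Literature.Analysis.FunctionSpaces.Torus.eGradNormSq (u t))).toReal) → ∃ (q Tb ν₀ : ℝ), 0 < q ∧ 0 < Tb ∧ 0 < ν₀ ∧ ∀ (ν : ℝ) (u₀ : UnitAddTorus (Fin 3) → EuclideanSpace ℝ (Fin 3)) (u : ℝ → UnitAddTorus (Fin 3) → EuclideanSpace ℝ (Fin 3)), 0 < ν → ν < ν₀ → Literature.Analysis.FluidPDE.Torus.IsGlobalLerayHopf ν (fun _ => f) u₀ u → MeasureTheory.MemLp u₀ 2 MeasureTheory.volume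 → MeasureTheory.eLpNorm (u₀ - U₀) 2 MeasureTheory.volume ≤ ENNReal.ofReal δ₂ → q ≤ ν * (MeasureTheory.lintegral (MeasureTheory.Measure.restrict MeasureTheory.volume (Set.Ioo 0 Tb)) (fun t => Literature.Analysis.FunctionSpaces.Torus.eGradNormSq (u t))).toReal

/-- item stmt-AnomalousDissipation-1186 · support · rank 4 · open · by planner
why it might fail: Content = known relative-energy estimate; only the typing fails: lacking MemLp u0 2 volume, non-measurable data U(0)*1_A (inner measure 0, outer 1) are LH data of the rest flow, eLpNorm(u0-U 0)=0, so the decl also claims O(nu) burn from rest on [0,T] whenever f has a classical solution: unprovable.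
sources: BrenierDeLellisSzekelyhidi2011, BrueDeLellis2023, Bardos2018, Wiedemann2018, Constantin1986, Literature.Barriers.AnomalousDissipation.BrenierDeLellisSzekelyhidi2011_cor1
[crux, rank 4 — THE ENGINE, provable now] Window stability of Leray–Hopf solutions around a
classical forced-Euler solution with the SAME smooth steady force on T³: if (U,P) is a classical
solution of forced Euler on [0,T] then there is C = C(U,T) (e.g. (1+2Λe^{2Λ})·max(1,∫₀ᵀ‖∇U‖₂²), Λ =
∫₀ᵀ‖∇U‖_∞) such that for every ν>0, δ≥0 and every GLOBAL Leray–Hopf solution u of NS_ν from a datum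
u₀ with ‖u₀ − U(0)‖_{L²} ≤ δ: ν∫₀ᵀ‖∇u‖₂² ≤ C(δ² + ν) (spectral eGradNormSq, lintegral on (0,T), as
in the energy inequality). Proof map: relative energy R = ½‖u−U‖²; test the torus weak formulation
(IsWeakNSSolutionForcedOn, datum term included) with U·χ, use energy_ineq_zero and the forced-Euler
energy equality; forces cancel; (u,U·∇U) − (u⊗u:∇U) = −∫(w·∇U)·w, w = u−U; ν(∇u,∇U) ≤ ν/2‖∇u‖² +
ν/2‖∇U‖²; Grönwall with 2‖∇U‖_∞. Templates in tree: BrenierDeLellisSzekelyhidi2011_cor1_holds (whole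
space, unforced, LH) and BrueDeLellis2023_lemma7_convergence_holds (torus, forced, classical NS; BDL
leave the Leray case 'to the reader', arXiv:2207.06301 p.18). Consumers: BreakdownOfIgnition,
CalmRecurrenceNoAnomaly, refuters of every witness route. Sources: BrueDeLellis2023 App. Lemma 7;
BrenierDeLellisSzekely -/
@[route_item "route-AnomalousDissipation-Sparks"]
def WindowStability : Prop :=
  ∀ (T : ℝ), 0 < T → ∀ (f : UnitAddTorus (Fin 3) → EuclideanSpace ℝ (Fin 3)), Literature.Analysis.FunctionSpaces.Torus.IsSmooth f → ∀ (U : ℝ → UnitAddTorus (Fin 3) → EuclideanSpace ℝ (Fin 3)) (P : ℝ → UnitAddTorus (Fin 3) → ℝ), Literature.Analysis.FunctionSpaces.Torus.IsClassicalNSSolutionOn (Set.Icc 0 T) 0 (fun _ => f) U P → ∃ C : ℝ, ∀ (ν δ : ℝ) (u₀ : UnitAddTorus (Fin 3) → EuclideanSpace ℝ (Fin 3)) (u : ℝ → UnitAddTorus (Fin 3) → EuclideanSpace ℝ (Fin 3)), 0 < ν → 0 ≤ δ → Literature.Analysis.FluidPDE.Torus.IsGlobalLerayHopf ν (fun _ =>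 f) u₀ u → MeasureTheory.MemLp u₀ 2 MeasureTheory.volume → MeasureTheory.eLpNorm (u₀ - U 0) 2 MeasureTheory.volume ≤ ENNReal.ofReal δ → ν * (MeasureTheory.lintegral (MeasureTheory.Measure.restrict MeasureTheory.volume (Set.Ioo 0 T)) (fun t => Literature.Analysis.FunctionSpaces.Torus.eGradNormSq (u t))).toReal ≤ C * (δ ^ 2 + ν)

/-- item stmt-AnomalousDissipation-1187 · support · rank 9 · open · by planner
sources: BrueDeLellis2023, Constantin2007, Hopf1951
[support — the PRICE theorem, provable from WindowStability +
Literature.Analysis.FluidPDE.hopf_existence_torus(.steady, DISCHARGED)] If a smooth div-free state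
U₀ IGNITES under the smooth steady force f (∃ q,δ,ν₀,Tb>0: every global LH solution of NS_ν, ν<ν₀,
from a datum δ-close to U₀ in L² burns ν∫₀^{Tb}‖∇u‖² ≥ q), then smooth-forced Euler from U₀ breaks
down before Tb: no classical solution on [0,Tb] has U 0 = U₀. Proof: else WindowStability gives C;
take ν < min(ν₀, q/(2C+1)) and the Hopf solution from U₀ itself (distance 0; MemLp/weakly div-free
from smoothness): q ≤ ν∫₀^{Tb}‖∇u‖² ≤ C·ν < q. Consequence: SparksThesis ⇒
SteadyForcedEulerBreakdown at every calm state met by RETURN — Bruè–De Lellis's deterrent as a typed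
long-time theorem. Sources: BrueDeLellis2023 §1; Constantin2007 §3.1; Hopf1951. -/
@[route_item "route-AnomalousDissipation-Sparks"]
def BreakdownOfIgnition : Prop :=
  ∀ f : UnitAddTorus (Fin 3) → EuclideanSpace ℝ (Fin 3), Literature.Analysis.FunctionSpaces.Torus.IsSmooth f → Literature.Analysis.FunctionSpaces.Torus.IsDivFree f → Literature.Analysis.FunctionSpaces.Torus.HasZeroMean f → ∀ (U₀ : UnitAddTorus (Fin 3) → EuclideanSpace ℝ (Fin 3)), Literature.Analysis.FunctionSpaces.Torus.IsSmooth U₀ → Literature.Analysis.FunctionSpaces.Torus.IsDivFree U₀ → ∀ (q δ ν₀ Tb : ℝ), 0 < q → 0 < δ → 0 < ν₀ → 0 < Tb → (∀ (ν : ℝ) (u₀ : UnitAddTorus (Fin 3) → EuclideanSpace ℝ (Fin 3)) (u : ℝ → UnitAddTorus (Fin 3) → EuclideanSpace ℝ (Fin 3)), 0 < ν → ν < ν₀ → Literature.Analysis.FluidPDE.Torus.IsGlobalLerayHopf ν (fun _ => f) u₀ u → MeasureTheory.MemLp u₀ 2 MeasureTheory.volume → MeasureTheory.eLpNorm (u₀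 - U₀) 2 MeasureTheory.volume ≤ ENNReal.ofReal δ → q ≤ ν * (MeasureTheory.lintegral (MeasureTheory.Measure.restrict MeasureTheory.volume (Set.Ioo 0 Tb)) (fun t => Literature.Analysis.FunctionSpaces.Torus.eGradNormSq (u t))).toReal) → ∀ (U : ℝ → UnitAddTorus (Fin 3) → EuclideanSpace ℝ (Fin 3)) (P : ℝ → UnitAddTorus (Fin 3) → ℝ), Literature.Analysis.FunctionSpaces.Torus.IsClassicalNSSolutionOn (Set.Icc 0 Tb) 0 (fun _ => f) U P → U 0 ≠ U₀

/-- item stmt-AnomalousDissipation-1188 · support · rank 9 · open · by planner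
sources: BrueDeLellis2023, BrenierDeLellisSzekelyhidi2011, Constantin2007, DoeringFoias2002
[support — unconditional, all-routes deliverable T2': 'turbulence cannot rest near tame Euler data']
Let f be smooth, S a set of states and Tr>0 such that the window bound of WindowStability holds
UNIFORMLY near S on windows of length 2Tr (∃ C ∀ U₀∈S ∀ν>0 ∀δ≥0 ∀ global LH u from u₀ with ‖u₀−U₀‖₂
≤ δ: ν∫₀^{2Tr}‖∇u‖² ≤ C(δ²+ν); e.g. S a C^k-compact set of smooth data each launching a classical
forced-Euler solution on [0,2Tr] — that Kato/compactness upgrade is deliberately NOT filed yet).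
Then every family (ν_j→0, global LH solutions u_j) that is RECURRENTLY CALM near S with radii δ_j→0
— each window [kTr,(k+1)Tr] contains a good restart time s with u_j(s) δ_j-close in L² to S — has
meanDissipation (ν_j) (u_j) → 0, hence witnesses no zeroth law. Proof: restarts at s_k cover
[(k+1)Tr,(k+2)Tr] ⊆ [s_k, s_k+2Tr]; translate lintegrals; Cesàro means ≤ D₀ⱼ/(nTr) + C(δ_j²+ν_j)/Tr,
and ≥ 0; tools Torus.IsLerayHopfOn.intervalIntegral_dissipation_eq/_le (DoeringFoiasProofs). Use:
any witness design (ECS branches, KAM wakes, octave towers, sparks) revisiting ν-uniformly smooth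
states at bounded intervals must place them where forced Euler is NOT uniformly tame, i.e.
presupposes breakdown; offere -/
@[route_item "route-AnomalousDissipation-Sparks"]
def CalmRecurrenceNoAnomaly : Prop :=
  ∀ f : UnitAddTorus (Fin 3) → EuclideanSpace ℝ (Fin 3), Literature.Analysis.FunctionSpaces.Torus.IsSmooth f → ∀ (S : Set (UnitAddTorus (Fin 3) → EuclideanSpace ℝ (Fin 3))) (Tr C : ℝ), 0 < Tr → (∀ U₀ ∈ S, ∀ (ν δ : ℝ) (u₀ : UnitAddTorus (Fin 3) → EuclideanSpace ℝ (Fin 3)) (u : ℝ → UnitAddTorus (Fin 3) → EuclideanSpace ℝ (Fin 3)), 0 < ν → 0 ≤ δ → Literature.Analysis.FluidPDE.Torus.IsGlobalLerayHopf ν (fun _ => f) u₀ u → MeasureTheory.MemLp u₀ 2 MeasureTheory.volume → MeasureTheory.eLpNorm (u₀ - U₀) 2 MeasureTheory.volume ≤ ENNReal.ofReal δ → ν * (MeasureTheory.lintegral (MeasureTheory.Measure.restrict MeasureTheory.volume (Set.Ioo 0 (2 * Tr))) (fun t => Literature.Analysis.FunctionSpaces.Torus.eGradNormSq (u t))).toReal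 ≤ C * (δ ^ 2 + ν)) → ∀ (ν δ : ℕ → ℝ) (u₀ : ℕ → UnitAddTorus (Fin 3) → EuclideanSpace ℝ (Fin 3)) (u : ℕ → ℝ → UnitAddTorus (Fin 3) → EuclideanSpace ℝ (Fin 3)), (∀ j, 0 < ν j) → Filter.Tendsto ν Filter.atTop (nhds 0) → (∀ j, 0 ≤ δ j) → Filter.Tendsto δ Filter.atTop (nhds 0) → (∀ j, Literature.Analysis.FluidPDE.Torus.IsGlobalLerayHopf (ν j) (fun _ => f) (u₀ j) (u j)) → (∀ (j k : ℕ), ∃ s ∈ Set.Icc ((k : ℝ) * Tr) (((k : ℝ) + 1) * Tr), Literature.Analysis.FluidPDE.Torus.IsGlobalLerayHopf (ν j) (fun _ => f) (u j s) (fun t => u j (s + t)) ∧ ∃ U₀ ∈ S, MeasureTheory.eLpNorm (u j s - U₀) 2 MeasureTheory.volume ≤ ENNReal.ofReal (δ j)) → Filter.Tendsto (fun j => Literature.Analysis.FluidPDE.meanDissipation (ν j) (u j)) Filter.atTop (nhds 0)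

/-- item stmt-AnomalousDissipation-14548 · support · rank 9 · open · by planner
sources: DoeringFoias2002, Hopf1951
[support — GLUE of the cruxes into the target; the item that makes SparksThesis reachable]
SingularitiesDissipate → UniformIgnition → RecurrentBlowupBall → SparksThesis. PROVED in the
planner's Sketch.lean (35 lines, lean check rc 0, attached as evidence): from RecurrentBlowupBall
take f, U₀, δ₂ < δ₁, T, E, Tr, ν₁, the blow-up ball and the deep return; SingularitiesDissipate at
each smooth div-free V of the ball (breakdown by T) gives pointwise ignition with window T + τ_V;
UniformIgnition gives (q, Tb, ν₀) uniform on B_{δ₂}(U₀); choose N : ℕ with Tb < N·Tr (exists_nat_gt,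
div_lt_iff₀; N ≥ 1); witnesses of X: S = {U₀}, δ = δ₂, q, E, Tb, Tr' = N·Tr, ν₀' = min ν₀ ν₁;
IGNITION by Set.mem_singleton_iff; RETURN: window k of length N·Tr contains window k·N of length Tr
((kN+1)Tr ≤ (k+1)N·Tr as N ≥ 1), push_cast + nlinarith. [deps: SingularitiesDissipate,
UniformIgnition, RecurrentBlowupBall, SparksThesis] [difficulty: provable-now] Sources: Hopf1951
(framework only); DoeringFoias2002 §2. -/
@[route_item "route-AnomalousDissipation-Sparks", crux]
def IgnitionReturnGlue : Prop :=
  SingularitiesDissipate → UniformIgnition → RecurrentBlowupBall → SparksThesis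

/-- item stmt-AnomalousDissipation-14549 · support · rank 9 · open · by planner
sources: BrueDeLellisCMP2023
[support — the ball crux refines the named breakdown crux] RecurrentBlowupBall →
SteadyForcedEulerBreakdown: instantiate the blow-up ball at its own centre V := U₀ (eLpNorm (U₀ −
U₀) 2 volume = 0 ≤ ofReal δ₁ by simp). PROVED in the planner's Sketch.lean (4 lines). Records
formally that a proof of global regularity for smooth steadily-forced Euler on T³ (¬#2) kills #4.
[deps: RecurrentBlowupBall, SteadyForcedEulerBreakdown] [difficulty: provable-now] Sources:
BrueDeLellisCMP2023 §1. -/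
@[route_item "route-AnomalousDissipation-Sparks"]
def BreakdownOfBall : Prop :=
  RecurrentBlowupBall → SteadyForcedEulerBreakdown

/-- item stmt-AnomalousDissipation-1189 · assembly · rank 1 · open · by planner
sources: DoeringFoias2002, Hopf1951
[assembly] SparksThesis → AnomalousDissipation (= Literature.Turb.ZerothLaw), cycle bookkeeping: ν_j
:= ν₀/(j+2); (u₀ j, u j) from RETURN; meanEnergy ≤ E (Cesàro means of a function bounded by E,
cobounded by 0; E ≥ 0 from t=0); apply IGNITION to the restarts (fun t => u (s_k+t)) — global LH
from u s_k, δ-calm — to get ν(∫⁻_{(s_k,s_k+Tb)} eGradNormSq).toReal ≥ q after translating the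
lintegral; the windows for even k are disjoint since Tb ≤ Tr, so for T ∈ [(2n+2)Tr,(2n+4)Tr) the
Cesàro mean is ≥ (n+1)q/T ≥ q/(4Tr); the means are bounded above by ½E/T + ‖f‖₂√E
(Torus.IsLerayHopfOn.intervalIntegral_dissipation_le + intervalIntegral_power_bounds) and equal
ν(∫⁻_{(0,T)}·).toReal/T (…intervalIntegral_dissipation_eq), so limsup ≥ q/(4Tr) =: ε > 0. Elementary
real analysis + in-tree LH lemmas; ~400–700 lines. Sources: DoeringFoias2002 §2; Hopf1951. -/
@[route_item "route-AnomalousDissipation-Sparks", crux]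
def Assembly : Prop :=
  (∃ f : UnitAddTorus (Fin 3) → EuclideanSpace ℝ (Fin 3), Literature.Analysis.FunctionSpaces.Torus.IsSmooth f ∧ Literature.Analysis.FunctionSpaces.Torus.IsDivFree f ∧ Literature.Analysis.FunctionSpaces.Torus.HasZeroMean f ∧ ∃ (S : Set (UnitAddTorus (Fin 3) → EuclideanSpace ℝ (Fin 3))) (δ q E Tb Tr ν₀ : ℝ), 0 < δ ∧ 0 < q ∧ 0 < Tb ∧ Tb ≤ Tr ∧ 0 < ν₀ ∧ (∀ (ν : ℝ) (u₀ : UnitAddTorus (Fin 3) → EuclideanSpace ℝ (Fin 3)) (u : ℝ → UnitAddTorus (Fin 3) → EuclideanSpace ℝ (Fin 3)), 0 < ν → ν < ν₀ → Literature.Analysis.FluidPDE.Torus.IsGlobalLerayHopf ν (fun _ => f) u₀ u → MeasureTheory.MemLp u₀ 2 MeasureTheory.volume → (∃ U ∈ S, MeasureTheory.eLpNorm (u₀ - U) 2 MeasureTheory.volume ≤ ENNReal.ofReal δ) → q ≤ ν * (MeasureTheory.lintegral (MeasureTheory.Measure.restrict MeasureTheory.volume (Set.Ioo 0 Tb)) (fun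 t => Literature.Analysis.FunctionSpaces.Torus.eGradNormSq (u t))).toReal) ∧ (∀ (ν : ℝ), 0 < ν → ν < ν₀ → ∃ (u₀ : UnitAddTorus (Fin 3) → EuclideanSpace ℝ (Fin 3)) (u : ℝ → UnitAddTorus (Fin 3) → EuclideanSpace ℝ (Fin 3)), Literature.Analysis.FluidPDE.Torus.IsGlobalLerayHopf ν (fun _ => f) u₀ u ∧ (∀ t : ℝ, 0 ≤ t → MeasureTheory.integral MeasureTheory.volume (fun x => ‖u t x‖ ^ 2) ≤ E) ∧ ∀ k : ℕ, ∃ s ∈ Set.Icc ((k : ℝ) * Tr) (((k : ℝ) + 1) * Tr), Literature.Analysis.FluidPDE.Torus.IsGlobalLerayHopf ν (fun _ => f) (u s) (fun t => u (s + t)) ∧ ∃ U ∈ S, MeasureTheory.eLpNorm (u s - U) 2 MeasureTheory.volume ≤ ENNReal.ofReal δ)) → AnomalousDissipation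

/-! D-0027 §2.1 — DECIDING THEOREM (planner-authored via `route open/edit --closes-file`; by planner-rchoice-AnomalousDissipation-Sparks-ta-50eb1848-0 2026-08-16T03:31:42Z):
its hypotheses are this route's items and its conclusion the sub-problem Statement (glue_lint), and it elaborates with this file. -/

@[closes "route-AnomalousDissipation-Sparks"] theorem closes (h₃ : SingularitiesDissipate) (h₅ : UniformIgnition) (h₄ : RecurrentBlowupBall)
    (hg : IgnitionReturnGlue) (hA : Assembly) : _root_.AnomalousDissipation :=
  -- cruxes #3, #5, #4 give the target SparksThesis (support IgnitionReturnGlue); the target gives the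
  -- Statement by cycle bookkeeping (item Assembly, whose antecedent is the SparksThesis body verbatim)
  hA (hg h₃ h₅ h₄)

end Summit.AnomalousDissipation.AnomalousDissipation.Theses.Sparks
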